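import Summits.BirchSwinnertonDyer.BirchSwinnertonDyer.Theorems.ByReductionTypeAtTwoMultTowerSplitExactOddCyclotomicNorm
import HarnessLib

/-!
# Route `ByReductionTypeAtTwo`, crux `MultUpperHalfAtTwo` (item stmt-BirchSwinnertonDyer-19922), TOWER road, SPLIT rows:
# the EXACT order of the local tower kernel at a split multiplicative prime, part 7 (ODD `p`) — the NORM GROUP of the
# local layer `F_m`: `N(F_mˣ) = ⟨p⟩ · {w : w^{p−1} ≡ 1 (mod p^{m+1})}`

HONEST FRAMING (cell `bsd-2adic`, run/shared/lean/pub/bsd-2adic/, seat `bsd-2adic-tower-1` GEN 27, HUMAN RULINGS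
D-0036 / D-0054 / D-0074): TOOL theorems only (no definition, no named fact, no `sorry`); closes nothing by itself;
nothing booked; BSD is not proved by any of this. Fourth ODD-`p` module towards the `∀ p` named fact
`hSP = Greenberg1999.sec3_natCard_localTowerKerPrimary_splitMultiplicative_rat` — the odd-`p` analogue of GEN 9's
BRICK 14 `MultTowerNS2.mem_range_norm_fixedField_layer_iff` (`p = 2`: `N(F_mˣ) = ⟨2⟩ · ±(1 + 2^{m+2}ℤ₂)`):

* `exists_subgroup_oddLayerNorm_pos` — part 4's subgroup `T_m = ⟨p⟩ · {w : w^{p−1} ≡ 1 (mod p^{m+1})}` of `ℚ_pˣ` with its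
  index `≤ p^m` AND FINITE (`0 <` index — the kernel of a homomorphism to the finite group `(ℤ/p^{m+1})ˣ`; part 4 recorded
  only the upper bound, which does not exclude index `0`);
* `mem_range_norm_fixedField_layer_iff_odd` — **`N(F_mˣ) = e⁻¹(T_m)`** for a ring isomorphism `e : ℚ_v ≃ ℚ_p`: the norm group
  CONTAINS `p = N(η_m)` (part 6), every `p^m`-th power, and every unit `w` with `w^{p−1} ≡ 1 (mod p^{m+1})`
  (`w^{p−1} ∈ (ℤ_pˣ)^{p^m} ⊆ N` by part 4's Hensel lemma and `w^{p^m} ∈ N`, with `gcd(p − 1, p^m) = 1`), hence `e⁻¹(T_m)`;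
  both have index `p^m` (class field axiom `index_range_norm_fixedField_layer`; `p^m ∣ [ℚ_vˣ : e⁻¹ T_m] ≤ p^m`), so they
  are equal (`MultTowerNS2.subgroup_eq_of_le_of_index_eq`).

References: J. Neukirch, *Algebraic Number Theory*, Ch. II (5.7), Ch. V §1 (1.1); L. Washington, *Introduction to
Cyclotomic Fields*, §13.1; cell memo NOTE-HNS2-KERNEL-GEN27.md (Stage D plan).
-/

set_option autoImplicit false
-- the Theorems namespace of this sub repeats the summit name by design (D-0017 nested layout: Summit.<S>.<Sub>)
set_option linter.dupNamespace false

noncomputable section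

open scoped Classical IntermediateField

namespace Summit.BirchSwinnertonDyer.BirchSwinnertonDyer.Theorems.MultTowerSplitExact

open NumberField IsDedekindDomain Field PadicInt Literature.NumberTheory.EllipticCurves
  Literature.NumberTheory.GaloisRepresentations

variable {p : ℕ} [hp : Fact p.Prime] {κ : ZpExtension ℚ p}

/-! ### `T_m` has finite index -/

/-- **The subgroup `T_m = ⟨p⟩ · {w : w^{p−1} ≡ 1 (mod p^{m+1})}` of `ℚ_pˣ` (odd `p`), with `0 < [ℚ_pˣ : T_m] ≤ p^m`.** As in
part 4 (`exists_subgroup_oddLayerNorm`, whose statement records only `≤ p^m`): `T_m` is the kernel of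
`x ↦ (unit part of x mod p^{m+1})^{p−1}` into the finite cyclic group `(ℤ/p^{m+1})ˣ`, whose image is killed by `p^m`.
[cite: NeukirchANT1999, Ch. II (5.7)] [cite: Serre1973, Ch. II §3.2] -/
theorem exists_subgroup_oddLayerNorm_pos (hp2 : p ≠ 2) (m : ℕ) :
    ∃ T : Subgroup ℚ_[p]ˣ,
      (∀ x : ℚ_[p]ˣ, x ∈ T ↔ ∃ (j : ℤ) (w : ℤ_[p]ˣ),
        toZModPow (m + 1) (((w : ℤ_[p])) ^ (p - 1)) = 1 ∧
          (x : ℚ_[p]) = (p : ℚ_[p]) ^ j * ((w : ℤ_[p]) : ℚ_[p])) ∧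
      T.index ≤ p ^ m ∧ 0 < T.index := by
  have hp0 : (p : ℚ_[p]) ≠ 0 := by exact_mod_cast hp.out.ne_zero
  -- the unit-part homomorphism `ℚ_pˣ → ℤ_pˣ`
  have hdec : ∀ x : ℚ_[p]ˣ, ∃ (j : ℤ) (w : ℤ_[p]ˣ), (x : ℚ_[p]) = (p : ℚ_[p]) ^ j * ((w : ℤ_[p]) : ℚ_[p]) :=
    fun x ↦ exists_eq_prime_zpow_mul_units (x : ℚ_[p]) x.ne_zero
  choose jv wv hjw using hdec
  let υ : ℚ_[p]ˣ →* ℤ_[p]ˣ :=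
    { toFun := wv
      map_one' := by
        have h := hjw 1
        rw [Units.val_one, show (1 : ℚ_[p]) = (p : ℚ_[p]) ^ (0 : ℤ) * (((1 : ℤ_[p]ˣ) : ℤ_[p]) : ℚ_[p])
          by simp] at h
        exact (prime_zpow_mul_units_inj h).2.symm
      map_mul' := fun x y ↦ by
        have h := hjw (x * y)
        rw [Units.val_mul, hjw x, hjw y, show (p : ℚ_[p]) ^ jv x * ((wv x : ℤ_[p]) : ℚ_[p]) *
            ((p : ℚ_[p]) ^ jv y * ((wv y : ℤ_[p]) : ℚ_[p])) =
            (p : ℚ_[p]) ^ (jv x + jv y) * (((wv x * wv y : ℤ_[p]ˣ) : ℤ_[p]) : ℚ_[p]) by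
          rw [zpow_add₀ hp0]; push_cast; ring] at h
        exact (prime_zpow_mul_units_inj h).2.symm }
  have hυ : ∀ (x : ℚ_[p]ˣ) (j : ℤ) (w : ℤ_[p]ˣ),
      (x : ℚ_[p]) = (p : ℚ_[p]) ^ j * ((w : ℤ_[p]) : ℚ_[p]) → υ x = w := by
    intro x j w h
    rw [hjw x] at h
    exact (prime_zpow_mul_units_inj h).2
  -- reduction modulo `p^{m+1}` followed by the `(p−1)`-th power
  let ρ : ℤ_[p]ˣ →* (ZMod (p ^ (m + 1)))ˣ := Units.map (toZModPow (p := p) (m + 1)).toMonoidHom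
  let π : (ZMod (p ^ (m + 1)))ˣ →* (ZMod (p ^ (m + 1)))ˣ := powMonoidHom (p - 1)
  let ψ : ℚ_[p]ˣ →* (ZMod (p ^ (m + 1)))ˣ := π.comp (ρ.comp υ)
  refine ⟨ψ.ker, fun x ↦ ?_, ?_, ?_⟩
  · -- membership
    rw [MonoidHom.mem_ker]
    change (ρ (υ x)) ^ (p - 1) = 1 ↔ _
    have hρ : ∀ w : ℤ_[p]ˣ, (((ρ w) ^ (p - 1) : (ZMod (p ^ (m + 1)))ˣ) : ZMod (p ^ (m + 1))) =
        toZModPow (m + 1) (((w : ℤ_[p])) ^ (p - 1)) := fun w ↦ by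
      rw [Units.val_pow_eq_pow_val, map_pow]; rfl
    constructor
    · intro h
      refine ⟨jv x, υ x, ?_, hjw x⟩
      rw [← hρ, h, Units.val_one]
    · rintro ⟨j, w, hw, hx⟩
      rw [hυ x j w hx]
      exact Units.ext (by rw [hρ, hw, Units.val_one])
  · -- index `≤ p^m`
    haveI : NeZero (p ^ (m + 1)) := ⟨pow_ne_zero _ hp.out.ne_zero⟩
    haveI hcyc : IsCyclic (ZMod (p ^ (m + 1)))ˣ := ZMod.isCyclic_units_of_prime_pow p hp.out hp2 (m + 1)
    have hcardG : Fintype.card (ZMod (p ^ (m + 1)))ˣ = (p - 1) * p ^ m := by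
      rw [ZMod.card_units_eq_totient, Nat.totient_prime_pow hp.out (by omega), Nat.add_sub_cancel, mul_comm]
    have hkill : ∀ c ∈ ψ.range, c ^ p ^ m = 1 := by
      rintro c ⟨x, rfl⟩
      change ((ρ (υ x)) ^ (p - 1)) ^ p ^ m = 1
      rw [← pow_mul, ← hcardG, pow_card_eq_one]
    have hsub : (ψ.range : Set (ZMod (p ^ (m + 1)))ˣ) ⊆
        ↑(Finset.univ.filter (fun a : (ZMod (p ^ (m + 1)))ˣ ↦ a ^ p ^ m = 1)) := by
      intro c hc
      simp only [Finset.coe_filter, Finset.mem_univ, true_and, Set.mem_setOf_eq]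
      exact hkill c hc
    have hle : Nat.card ψ.range ≤ p ^ m := by
      have h1 : Nat.card ψ.range ≤ Nat.card (↑(Finset.univ.filter (fun a : (ZMod (p ^ (m + 1)))ˣ ↦ a ^ p ^ m = 1)) :
          Set (ZMod (p ^ (m + 1)))ˣ) := Nat.card_mono (Set.toFinite _) hsub
      rw [Nat.card_coe_set_eq, Set.ncard_coe_finset] at h1
      exact h1.trans (IsCyclic.card_pow_eq_one_le (pow_pos hp.out.pos m))
    rw [Subgroup.index_ker]
    exact hle
  · -- finite index: the range is a (nonempty) subgroup of a finite group
    rw [Subgroup.index_ker]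
    exact Nat.card_pos

/-! ### The norm group of `F_m` (odd `p`) -/

/-- **`N(F_mˣ) = ⟨p⟩ · {w : w^{p−1} ≡ 1 (mod p^{m+1})}`** (odd `p`), read through a ring isomorphism `e : ℚ_v ≃ ℚ_p`: a unit
`x` of `ℚ_v` is a norm from the `m`-th local layer `F_m` of the cyclotomic `ℤ_p`-tower iff `e x = p^j · w` with `w ∈ ℤ_pˣ`,
`w^{p−1} ≡ 1 (mod p^{m+1})`. The norm group CONTAINS `p = N(η_m)` (part 6), every `p^m`-th power, and every such unit `w`
(`w^{p−1} = c^{p^m}` by part 4, `w^{p^m}` is a norm, `gcd(p−1, p^m) = 1`), hence `e⁻¹(T_m)`; both have index `p^m`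
(class field axiom; `p^m ∣ [ℚ_vˣ : e⁻¹ T_m] ≤ p^m`), so they are equal. [cite: NeukirchANT1999, Ch. V §1 Thm. (1.1)]
[cite: Washington1997, §13.1] -/
theorem mem_range_norm_fixedField_layer_iff_odd (hp2 : p ≠ 2) (hκ : κ.IsCyclotomic) (v : HeightOneSpectrum (𝓞 ℚ))
    (hv : ((p : ℕ) : 𝓞 ℚ) ∈ v.asIdeal) (m : ℕ) (e : v.adicCompletion ℚ ≃+* ℚ_[p]) (x : (v.adicCompletion ℚ)ˣ) :
    x ∈ (Units.map (Algebra.norm (v.adicCompletion ℚ) :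
        IntermediateField.fixedField (localSubgroup (κ.layerSubgroup m) (v.adicCompletion ℚ)) →*
          v.adicCompletion ℚ)).range ↔
      ∃ (j : ℤ) (w : ℤ_[p]ˣ), toZModPow (m + 1) (((w : ℤ_[p])) ^ (p - 1)) = 1 ∧
        e (x : v.adicCompletion ℚ) = (p : ℚ_[p]) ^ j * ((w : ℤ_[p]) : ℚ_[p]) := by
  set F := IntermediateField.fixedField (localSubgroup (κ.layerSubgroup m) (v.adicCompletion ℚ)) with hF
  set S := (Units.map (Algebra.norm (v.adicCompletion ℚ) : F →* v.adicCompletion ℚ)).range with hS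
  haveI := MultTowerNS2.finiteDimensional_fixedField_localSubgroup_layerSubgroup (κ := κ) v m
  have hrank : Module.finrank (v.adicCompletion ℚ) F = p ^ m :=
    MultTowerNS2.finrank_fixedField_localSubgroup_layerSubgroup hκ v hv m
  have hp0 : ((p : ℕ) : v.adicCompletion ℚ) ≠ 0 := by
    rw [← map_natCast (algebraMap ℚ (v.adicCompletion ℚ))]
    exact (map_ne_zero_iff _ (algebraMap ℚ (v.adicCompletion ℚ)).injective).mpr (by exact_mod_cast hp.out.ne_zero)
  -- the subgroup `T = e⁻¹ (T_m)` of `ℚ_vˣ`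
  obtain ⟨Tp, hTp, hTpidx, hTppos⟩ := exists_subgroup_oddLayerNorm_pos hp2 m
  let eu : (v.adicCompletion ℚ)ˣ →* ℚ_[p]ˣ := Units.map (e : v.adicCompletion ℚ →* ℚ_[p])
  have heu : Function.Surjective eu := fun u ↦
    ⟨Units.map (e.symm : ℚ_[p] →* v.adicCompletion ℚ) u, Units.ext (by simp [eu])⟩
  set T := Tp.comap eu with hT
  have hTidx : T.index = Tp.index := by rw [hT, Subgroup.index_comap_of_surjective _ heu]
  have hmemT : ∀ y : (v.adicCompletion ℚ)ˣ, y ∈ T ↔ ∃ (j : ℤ) (w : ℤ_[p]ˣ),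
      toZModPow (m + 1) (((w : ℤ_[p])) ^ (p - 1)) = 1 ∧
        e (y : v.adicCompletion ℚ) = (p : ℚ_[p]) ^ j * ((w : ℤ_[p]) : ℚ_[p]) := by
    intro y
    rw [hT, Subgroup.mem_comap, hTp]
    rfl
  -- elements of `S`
  have hmemS : ∀ z : (v.adicCompletion ℚ)ˣ, z ∈ S ↔
      ∃ f : F, Algebra.norm (v.adicCompletion ℚ) f = (z : v.adicCompletion ℚ) := by
    intro z
    rw [hS, MonoidHom.mem_range]
    constructor
    · rintro ⟨f, hf⟩
      exact ⟨(f : F), by simp [← hf]⟩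
    · rintro ⟨f, hf⟩
      have hf0 : f ≠ 0 := by
        rintro rfl
        rw [Algebra.norm_zero] at hf
        exact z.ne_zero hf.symm
      exact ⟨Units.mk0 f hf0, Units.ext (by simp [hf])⟩
  -- `p ∈ S` (part 6) and `p^m`-th powers
  obtain ⟨f₀, hf₀⟩ := exists_norm_fixedField_layer_eq_prime hp2 hκ v hv m
  have hpS : Units.mk0 ((p : ℕ) : v.adicCompletion ℚ) hp0 ∈ S := (hmemS _).mpr ⟨f₀, by rw [hf₀, Units.val_mk0]⟩
  have hpow : ∀ z : (v.adicCompletion ℚ)ˣ, z ^ p ^ m ∈ S := fun z ↦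
    (hmemS _).mpr ⟨algebraMap (v.adicCompletion ℚ) F z, by
      rw [Algebra.norm_algebraMap, hrank, Units.val_pow_eq_pow_val]⟩
  -- units `w` with `w^{p−1} ≡ 1 (mod p^{m+1})`: `e⁻¹ w ∈ S`
  have hcop : IsCoprime ((p - 1 : ℕ) : ℤ) ((p ^ m : ℕ) : ℤ) := by
    rw [Nat.isCoprime_iff_coprime]
    have h1 : Nat.Coprime (p - 1) p :=
      ((Nat.Prime.coprime_iff_not_dvd hp.out).mpr
        (Nat.not_dvd_of_pos_of_lt (by have := hp.out.two_le; omega) (by have := hp.out.two_le; omega))).symm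
    exact h1.pow_right m
  obtain ⟨a, c, hac⟩ := hcop
  have hunit : ∀ w : ℤ_[p]ˣ, toZModPow (m + 1) (((w : ℤ_[p])) ^ (p - 1)) = 1 →
      ∀ b : (v.adicCompletion ℚ)ˣ, e (b : v.adicCompletion ℚ) = ((w : ℤ_[p]) : ℚ_[p]) → b ∈ S := by
    intro w hw b hb
    obtain ⟨c₀, hc₀⟩ := exists_units_pow_prime_pow_eq_of_toZModPow_eq_one hp2 m hw
    have hc1 : ‖((c₀ : ℤ_[p]) : ℚ_[p])‖ = 1 := PadicInt.norm_units c₀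
    have hcne : e.symm ((c₀ : ℤ_[p]) : ℚ_[p]) ≠ 0 := by
      rw [ne_eq, map_eq_zero_iff _ e.symm.injective]
      exact norm_pos_iff.mp (by rw [hc1]; norm_num)
    let b' : (v.adicCompletion ℚ)ˣ := Units.mk0 (e.symm ((c₀ : ℤ_[p]) : ℚ_[p])) hcne
    have h1 : b ^ (p - 1) = b' ^ p ^ m := by
      apply Units.ext
      apply e.injective
      rw [Units.val_pow_eq_pow_val, Units.val_pow_eq_pow_val, map_pow, map_pow, hb]
      change ((w : ℤ_[p]) : ℚ_[p]) ^ (p - 1) = (e (e.symm ((c₀ : ℤ_[p]) : ℚ_[p]))) ^ p ^ m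
      rw [RingEquiv.apply_symm_apply, ← PadicInt.coe_pow, ← PadicInt.coe_pow, hc₀]
    have hS1 : b ^ (p - 1) ∈ S := by rw [h1]; exact hpow b'
    have hS2 : b ^ p ^ m ∈ S := hpow b
    have key : (b ^ (p - 1)) ^ a * (b ^ p ^ m) ^ c = b := by
      rw [← zpow_natCast b (p - 1), ← zpow_natCast b (p ^ m), ← zpow_mul, ← zpow_mul, ← zpow_add,
        mul_comm, mul_comm _ c, hac, zpow_one]
    rw [← key]
    exact S.mul_mem (S.zpow_mem hS1 a) (S.zpow_mem hS2 c)
  -- `T ≤ S`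
  have hTS : T ≤ S := by
    intro z hz
    obtain ⟨j, w, hw, hz⟩ := (hmemT z).mp hz
    have hw1 : ‖((w : ℤ_[p]) : ℚ_[p])‖ = 1 := PadicInt.norm_units w
    have hwne : e.symm ((w : ℤ_[p]) : ℚ_[p]) ≠ 0 := by
      rw [ne_eq, map_eq_zero_iff _ e.symm.injective]
      exact norm_pos_iff.mp (by rw [hw1]; norm_num)
    let b : (v.adicCompletion ℚ)ˣ := Units.mk0 (e.symm ((w : ℤ_[p]) : ℚ_[p])) hwne
    have hb : e (b : v.adicCompletion ℚ) = ((w : ℤ_[p]) : ℚ_[p]) := by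
      change e (e.symm ((w : ℤ_[p]) : ℚ_[p])) = _
      rw [RingEquiv.apply_symm_apply]
    have hzprod : z = (Units.mk0 ((p : ℕ) : v.adicCompletion ℚ) hp0) ^ j * b := by
      apply Units.ext
      apply e.injective
      rw [hz, Units.val_mul, map_mul, Units.val_zpow_eq_zpow_val, map_zpow₀, Units.val_mk0, map_natCast, hb]
    rw [hzprod]
    exact S.mul_mem (S.zpow_mem hpS j) (hunit w hw b hb)
  -- equal indices `p^m`
  have hSidx : S.index = p ^ m := index_range_norm_fixedField_layer hκ v hv m
  have hTidx' : T.index = p ^ m := by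
    have hdvd : S.index ∣ T.index := Subgroup.index_dvd_of_le hTS
    rw [hSidx] at hdvd
    rw [hTidx] at hdvd ⊢
    exact le_antisymm hTpidx (Nat.le_of_dvd hTppos hdvd)
  have hTS' : T = S :=
    MultTowerNS2.subgroup_eq_of_le_of_index_eq hTS (hTidx'.trans hSidx.symm) (by rw [hSidx]; exact pow_ne_zero _ hp.out.ne_zero)
  rw [← hTS', hmemT]

end Summit.BirchSwinnertonDyer.BirchSwinnertonDyer.Theorems.MultTowerSplitExact

end
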